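import Summits.ValiantsHypothesis.ValiantsHypothesis.Theorems.SymPencilPerFourRowStabilizer
import Summits.ValiantsHypothesis.ValiantsHypothesis.Theorems.SymPencilPerFourRowNoLinearFactor

/-!
# Route `SymPencil` — exact flows of `per [v; ·]` on a hyperplane: the Jacobian criterion
# (tool file for the one-row defect-2 cell `(12,4,2)` of `sdc(per_4)`, `--supports`
# stmt-ValiantsHypothesis-5674; nothing here bears on `VP ≠ VNP`)

Fix `v ∈ K⁴` and the cubic form `F_v(y) = per [v; y 0; y 1; y 2]` on `3 × 4` matrices `y`, with
polar form `DF_v(y)[z] = per [v; z 0; y 1; y 2] + per [v; y 0; z 1; y 2] + per [v; y 0; y 1; z 2]`.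
A linear map `X` is an EXACT FLOW SYMMETRY of `F_v` ON THE HYPERPLANE `ker ℓ` if
`F_v(y + t·X y) = F_v(y)` for all `y ∈ ker ℓ` and all `t` (val-width-5674-w2 g2's (S1), vw l.1568:
the endgame of cell `(12,4,2)` asks that such an `X` vanish on `ker ℓ` unless `ℓ` is one of the
`per₂`-hyperplanes).

* `permanent_rows_add_smul_expand` — `F_v(y + t z)` as a cubic in `t`;
  `flow_orders` — an exact flow gives the three graded identities `DF_v(y)[X y] = 0`,
  `D²F_v(y)[X y, X y] = 0`, `F_v(X y) = 0` on `ker ℓ` (characteristic `0`).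
* `exists_permanent_ne_zero_of_ker` — `F_v` does not vanish identically on a hyperplane (`v ≠ 0`;
  otherwise `F_v = ℓ · B` for an explicit bilinear `B`, against
  `SymPencilPerFourRowNoLinearFactor.permanent_rows_ne_linear_mul_quadratic`).
* **`eq_zero_on_hyperplane_of_flow_of_jacobian`** (THE JACOBIAN CRITERION) — if the cubic
  `DF_v(y)[X y]` equals `ℓ(y) · DF_v(y)[w]` for a fixed matrix `w` (i.e. its quotient by `ℓ` lies in
  the span of the partials of `F_v`), then an exact flow symmetry `X` on `ker ℓ` vanishes on `ker ℓ`
  (all `v_j ≠ 0`, characteristic `0`).  Proof: `X − ℓ ⊗ w` is in the Lie stabiliser of `F_v`, hence a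
  traceless row scaling `R_α` (`SymPencilPerFourRowStabilizer.rowScaling_of_deriv_vanish`); on
  `ker ℓ` the flow multiplies `F_v` by `Π_a (1 + t α_a)`, and a point of `ker ℓ` with `F_v ≠ 0` forces
  `e₁(α) = e₂(α) = e₃(α) = 0`, i.e. `α = 0`.
* `eq_zero_of_flow` — the full-space case `ℓ = 0` (no Jacobian hypothesis needed).
* `exists_good_point_of_flow_of_jacobian` / `exists_good_point_of_flow_zero` — the same in the cell's
  `hrig` currency (`∃ y, ℓ y = 0 ∧ X y = 0 ∧ F_v(y) ≠ 0`, the hypothesis of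
  `SymPencilPerFourOneRowDefectTwoEndgame.false_of_flow_identities`).

What this isolates (honest): (S1) = this criterion + the statement that for a non-`per₂` hyperplane
the first-order identity forces the Jacobian hypothesis; the latter is NOT proved here. [folklore]
-/

noncomputable section

-- single-conjunct layout: Sub = Summit, duplicated namespace component intended
set_option linter.dupNamespace false

namespace Summit.ValiantsHypothesis.ValiantsHypothesis.Theorems.SymPencilPerFourHyperplaneFlow

open Matrix
open Summit.ValiantsHypothesis.ValiantsHypothesis.Theorems.SymPencilPerFourInnerRankRows
open Summit.ValiantsHypothesis.ValiantsHypothesis.Theorems.SymPencilPerFourRowForms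
open Summit.ValiantsHypothesis.ValiantsHypothesis.Theorems.SymPencilPerFourRowStabilizer
open Summit.ValiantsHypothesis.ValiantsHypothesis.Theorems.SymPencilPerFourRowNoLinearFactor

variable {K : Type*} [Field K]

/-! ### The flow polynomial -/

/-- `F_v(y + t z) = F_v(y) + t·DF_v(y)[z] + t²·D²F_v(y)[z,z] + t³·F_v(z)`. [folklore] -/
theorem permanent_rows_add_smul_expand (v : Fin 4 → K) (y z : Fin 3 → Fin 4 → K) (t : K) :
    (Matrix.of ![v, (y + t • z) 0, (y + t • z) 1, (y + t • z) 2]).permanent =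
      (Matrix.of ![v, y 0, y 1, y 2]).permanent
      + t * ((Matrix.of ![v, z 0, y 1, y 2]).permanent + (Matrix.of ![v, y 0, z 1, y 2]).permanent
              + (Matrix.of ![v, y 0, y 1, z 2]).permanent)
      + t ^ 2 * ((Matrix.of ![v, z 0, z 1, y 2]).permanent + (Matrix.of ![v, z 0, y 1, z 2]).permanent
              + (Matrix.of ![v, y 0, z 1, z 2]).permanent)
      + t ^ 3 * (Matrix.of ![v, z 0, z 1, z 2]).permanent := by
  simp only [permanent_of_rows, Pi.add_apply, Pi.smul_apply, smul_eq_mul]; ring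

/-- **The three graded identities of an exact flow** (characteristic `0`): if
`F_v(y + t z) = F_v(y)` for all `t`, then `DF_v(y)[z] = 0`, `D²F_v(y)[z,z] = 0` and `F_v(z) = 0`.
[folklore] -/
theorem flow_orders [CharZero K] (v : Fin 4 → K) (y z : Fin 3 → Fin 4 → K)
    (h : ∀ t : K, (Matrix.of ![v, (y + t • z) 0, (y + t • z) 1, (y + t • z) 2]).permanent =
      (Matrix.of ![v, y 0, y 1, y 2]).permanent) :
    ((Matrix.of ![v, z 0, y 1, y 2]).permanent + (Matrix.of ![v, y 0, z 1, y 2]).permanent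
        + (Matrix.of ![v, y 0, y 1, z 2]).permanent = 0) ∧
    ((Matrix.of ![v, z 0, z 1, y 2]).permanent + (Matrix.of ![v, z 0, y 1, z 2]).permanent
        + (Matrix.of ![v, y 0, z 1, z 2]).permanent = 0) ∧
    (Matrix.of ![v, z 0, z 1, z 2]).permanent = 0 := by
  have hc := cubic_coeffs_eq_zero (0 : K)
    ((Matrix.of ![v, z 0, y 1, y 2]).permanent + (Matrix.of ![v, y 0, z 1, y 2]).permanent
        + (Matrix.of ![v, y 0, y 1, z 2]).permanent)
    ((Matrix.of ![v, z 0, z 1, y 2]).permanent + (Matrix.of ![v, z 0, y 1, z 2]).permanent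
        + (Matrix.of ![v, y 0, z 1, z 2]).permanent)
    (Matrix.of ![v, z 0, z 1, z 2]).permanent fun t => by
      have h1 := h t
      rw [permanent_rows_add_smul_expand] at h1
      linear_combination h1
  exact ⟨hc.2.1, hc.2.2.1, hc.2.2.2⟩

/-! ### `F_v` does not vanish on a hyperplane -/

/-- **`per [v; ·]` does not vanish identically on a hyperplane** (`v ≠ 0`, characteristic `0`):
for every linear form `ℓ` there is `y ∈ ker ℓ` with `F_v(y) ≠ 0`.  (If not, expanding
`F_v(y − ℓ(y)·u) = 0` with `ℓ(u) = 1` writes `F_v = ℓ · B` for an explicit bilinear `B`, against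
`permanent_rows_ne_linear_mul_quadratic`.) [folklore] -/
theorem exists_permanent_ne_zero_of_ker [CharZero K] {v : Fin 4 → K} (hv : v ≠ 0)
    (ℓ : (Fin 3 → Fin 4 → K) →ₗ[K] K) :
    ∃ y : Fin 3 → Fin 4 → K, ℓ y = 0 ∧ (Matrix.of ![v, y 0, y 1, y 2]).permanent ≠ 0 := by
  classical
  by_cases hℓ : ℓ = 0
  · -- the whole space: `per [v; e_q; e_r; e_s] = v_p ≠ 0`
    obtain ⟨p, hp⟩ := Function.ne_iff.1 hv
    obtain ⟨q, r, s, hqr, hqs, hqp, hrs, hrp, hsp⟩ := exists_three_compl p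
    refine ⟨![Pi.single q 1, Pi.single r 1, Pi.single s 1], by rw [hℓ, LinearMap.zero_apply], ?_⟩
    simp only [Matrix.cons_val_zero, Matrix.cons_val_one, Matrix.cons_val_two, Matrix.tail_cons, Matrix.head_cons]
    rw [permanent_rows_three_single v q r s p ⟨hqr, hqs, hqp, hrs, hrp, hsp⟩]
    exact hp
  by_contra hcon
  push Not at hcon
  -- a vector with `ℓ u = 1`
  obtain ⟨u₀, hu₀⟩ : ∃ u₀, ℓ u₀ ≠ 0 := by
    by_contra h0
    push Not at h0
    exact hℓ (LinearMap.ext h0)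
  set u : Fin 3 → Fin 4 → K := (ℓ u₀)⁻¹ • u₀ with hu_def
  have hu : ℓ u = 1 := by rw [hu_def, map_smul, smul_eq_mul, inv_mul_cancel₀ hu₀]
  -- `F_v (y - ℓ y • u) = 0` for every `y`
  have hvan : ∀ y, (Matrix.of ![v, (y + (-ℓ y) • u) 0, (y + (-ℓ y) • u) 1, (y + (-ℓ y) • u) 2]).permanent = 0 :=
    fun y => hcon _ (by rw [map_add, map_smul, hu, smul_eq_mul, mul_one, add_neg_cancel])
  -- the bilinear form `B` with `F_v = ℓ · B`
  let B : (Fin 3 → Fin 4 → K) →ₗ[K] (Fin 3 → Fin 4 → K) →ₗ[K] K :=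
    LinearMap.mk₂ K
      (fun y z =>
        ((Matrix.of ![v, u 0, y 1, z 2]).permanent + (Matrix.of ![v, y 0, u 1, z 2]).permanent
            + (Matrix.of ![v, y 0, z 1, u 2]).permanent)
          - ℓ y * ((Matrix.of ![v, u 0, u 1, z 2]).permanent + (Matrix.of ![v, u 0, z 1, u 2]).permanent
            + (Matrix.of ![v, z 0, u 1, u 2]).permanent)
          + (Matrix.of ![v, u 0, u 1, u 2]).permanent * ℓ y * ℓ z)
      (fun y y' z => by
        simp only [Pi.add_apply, per_add_row₁, per_add_row₂, map_add]; ring)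
      (fun c y z => by
        simp only [Pi.smul_apply, permanent_rows_smul₁, per_smul_row₂, map_smul, smul_eq_mul]; ring)
      (fun y z z' => by
        simp only [Pi.add_apply, per_add_row₁, per_add_row₂, per_add_row₃, map_add]; ring)
      (fun c y z => by
        simp only [Pi.smul_apply, permanent_rows_smul₁, per_smul_row₂, per_smul_row₃, map_smul, smul_eq_mul]
        ring)
  refine permanent_rows_ne_linear_mul_quadratic hv ℓ B fun y => ?_
  have e := hvan y
  rw [permanent_rows_add_smul_expand] at e
  simp only [B, LinearMap.mk₂_apply]
  linear_combination e

/-! ### The Jacobian criterion -/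

/-- The exact flow of a row scaling multiplies `F_v` by `Π_a (1 + t α_a)`. [folklore] -/
theorem permanent_rows_rowScaling_flow (v : Fin 4 → K) (α : Fin 3 → K) (y : Fin 3 → Fin 4 → K) (t : K) :
    (Matrix.of ![v, y 0 + t • (α 0 • y 0), y 1 + t • (α 1 • y 1), y 2 + t • (α 2 • y 2)]).permanent =
      (1 + t * α 0) * (1 + t * α 1) * (1 + t * α 2) * (Matrix.of ![v, y 0, y 1, y 2]).permanent := by
  have e : ∀ (a : K) (r : Fin 4 → K), r + t • (a • r) = (1 + t * a) • r := fun a r => by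
    rw [add_smul, one_smul, mul_smul]
  rw [e, e, e, permanent_rows_smul₁, per_smul_row₂, per_smul_row₃]
  ring

/-- If `e₁(α) = e₂(α) = e₃(α) = 0` for three scalars then all three vanish. [folklore] -/
theorem eq_zero_of_symm_fun_eq_zero (α : Fin 3 → K) (h1 : α 0 + α 1 + α 2 = 0)
    (h2 : α 0 * α 1 + α 0 * α 2 + α 1 * α 2 = 0) (h3 : α 0 * α 1 * α 2 = 0) : ∀ a, α a = 0 := by
  have c0 : α 0 ^ 3 = 0 := by linear_combination (α 0 ^ 2) * h1 - (α 0) * h2 + h3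
  have c1 : α 1 ^ 3 = 0 := by linear_combination (α 1 ^ 2) * h1 - (α 1) * h2 + h3
  have c2 : α 2 ^ 3 = 0 := by linear_combination (α 2 ^ 2) * h1 - (α 2) * h2 + h3
  intro a
  fin_cases a
  · exact pow_eq_zero_iff (n := 3) (by norm_num) |>.1 c0
  · exact pow_eq_zero_iff (n := 3) (by norm_num) |>.1 c1
  · exact pow_eq_zero_iff (n := 3) (by norm_num) |>.1 c2

/-- **The Jacobian criterion for exact flows on a hyperplane** (all `v_j ≠ 0`, characteristic `0`).
Let `X` be linear on `3 × 4` matrices, `ℓ` a linear form and `w` a fixed matrix with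
`DF_v(y)[X y] = ℓ(y) · DF_v(y)[w]` for all `y` (the first-order cubic, divided by `ℓ`, is in the span
of the partials of `F_v`).  If `F_v(y + t·X y) = F_v(y)` for all `y ∈ ker ℓ` and all `t`, then `X`
vanishes on `ker ℓ`.  See the module docstring. [folklore] -/
theorem eq_zero_on_hyperplane_of_flow_of_jacobian [CharZero K] {v : Fin 4 → K} (hv : ∀ j, v j ≠ 0)
    (X : (Fin 3 → Fin 4 → K) →ₗ[K] (Fin 3 → Fin 4 → K)) (ℓ : (Fin 3 → Fin 4 → K) →ₗ[K] K)
    (w : Fin 3 → Fin 4 → K)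
    (hJ : ∀ y : Fin 3 → Fin 4 → K,
      (Matrix.of ![v, X y 0, y 1, y 2]).permanent + (Matrix.of ![v, y 0, X y 1, y 2]).permanent +
          (Matrix.of ![v, y 0, y 1, X y 2]).permanent =
        ℓ y * ((Matrix.of ![v, w 0, y 1, y 2]).permanent + (Matrix.of ![v, y 0, w 1, y 2]).permanent +
          (Matrix.of ![v, y 0, y 1, w 2]).permanent))
    (h : ∀ y, ℓ y = 0 → ∀ t : K,
      (Matrix.of ![v, (y + t • X y) 0, (y + t • X y) 1, (y + t • X y) 2]).permanent =
        (Matrix.of ![v, y 0, y 1, y 2]).permanent) :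
    ∀ y, ℓ y = 0 → X y = 0 := by
  classical
  -- `X' = X - ℓ ⊗ w` is in the Lie stabiliser of `F_v`
  set X' : (Fin 3 → Fin 4 → K) →ₗ[K] (Fin 3 → Fin 4 → K) := X - ℓ.smulRight w with hX'_def
  have hX'app : ∀ y a, X' y a = X y a + (-ℓ y) • w a := by
    intro y a
    rw [hX'_def, LinearMap.sub_apply, LinearMap.smulRight_apply, Pi.sub_apply, Pi.smul_apply, neg_smul,
      sub_eq_add_neg]
  have hX' : ∀ y : Fin 3 → Fin 4 → K,
      (Matrix.of ![v, X' y 0, y 1, y 2]).permanent + (Matrix.of ![v, y 0, X' y 1, y 2]).permanent +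
        (Matrix.of ![v, y 0, y 1, X' y 2]).permanent = 0 := by
    intro y
    have h1 := hJ y
    rw [hX'app, hX'app, hX'app, per_add_row₁, per_add_row₂, per_add_row₃, permanent_rows_smul₁, per_smul_row₂,
      per_smul_row₃]
    linear_combination h1
  obtain ⟨α, hαsum, hα⟩ := rowScaling_of_deriv_vanish hv X' hX'
  -- on `ker ℓ`, `X = X' = R_α`
  have hXker : ∀ y, ℓ y = 0 → ∀ a, X y a = α a • y a := by
    intro y hy a
    have h1 := hα y a
    rw [hX'app, hy, neg_zero, zero_smul, add_zero] at h1
    exact h1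
  -- the flow multiplies `F_v` by `Π (1 + t α_a)` on `ker ℓ`
  have hv0 : v ≠ 0 := fun h0 => hv 0 (by rw [h0, Pi.zero_apply])
  obtain ⟨y₀, hy₀, hF₀⟩ := exists_permanent_ne_zero_of_ker hv0 ℓ
  have hflow : ∀ t : K, ((1 + t * α 0) * (1 + t * α 1) * (1 + t * α 2) - 1) *
      (Matrix.of ![v, y₀ 0, y₀ 1, y₀ 2]).permanent = 0 := by
    intro t
    have h1 := h y₀ hy₀ t
    have e : ∀ a, (y₀ + t • X y₀) a = y₀ a + t • (α a • y₀ a) := fun a => by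
      rw [Pi.add_apply, Pi.smul_apply, hXker y₀ hy₀ a]
    rw [e, e, e, permanent_rows_rowScaling_flow] at h1
    linear_combination h1
  have hpoly : ∀ t : K, (1 + t * α 0) * (1 + t * α 1) * (1 + t * α 2) - 1 = 0 := fun t =>
    (mul_eq_zero.1 (hflow t)).resolve_right hF₀
  obtain ⟨-, e1, e2, e3⟩ := cubic_coeffs_eq_zero (0 : K) (α 0 + α 1 + α 2)
    (α 0 * α 1 + α 0 * α 2 + α 1 * α 2) (α 0 * α 1 * α 2) fun t => by
      linear_combination hpoly t
  have hα0 := eq_zero_of_symm_fun_eq_zero α e1 e2 e3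
  -- conclusion
  intro y hy
  funext a
  rw [hXker y hy a, hα0 a, zero_smul, Pi.zero_apply]

/-- **The full-space case** (`ℓ = 0`): an exact flow symmetry of `F_v` on all of `K^{3×4}` is zero
(all `v_j ≠ 0`, characteristic `0`). [folklore] -/
theorem eq_zero_of_flow [CharZero K] {v : Fin 4 → K} (hv : ∀ j, v j ≠ 0)
    (X : (Fin 3 → Fin 4 → K) →ₗ[K] (Fin 3 → Fin 4 → K))
    (h : ∀ y, ∀ t : K,
      (Matrix.of ![v, (y + t • X y) 0, (y + t • X y) 1, (y + t • X y) 2]).permanent =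
        (Matrix.of ![v, y 0, y 1, y 2]).permanent) :
    X = 0 := by
  refine LinearMap.ext fun y => ?_
  refine eq_zero_on_hyperplane_of_flow_of_jacobian hv X 0 0 (fun y' => ?_) (fun y' _ t => h y' t) y
    (LinearMap.zero_apply y)
  rw [LinearMap.zero_apply, zero_mul]
  exact (flow_orders v y' (X y') (h y')).1

/-- **The Jacobian criterion in the cell's `hrig` currency** (val-width-5674-w2 g2's
`SymPencilPerFourOneRowDefectTwoEndgame.false_of_flow_identities`, hypothesis `hrig`): under the Jacobian
hypothesis an exact flow symmetry on `ker ℓ` has a GOOD POINT — `y ∈ ker ℓ` with `X y = 0` and `F_v(y) ≠ 0`.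
[folklore] -/
theorem exists_good_point_of_flow_of_jacobian [CharZero K] {v : Fin 4 → K} (hv : ∀ j, v j ≠ 0)
    (X : (Fin 3 → Fin 4 → K) →ₗ[K] (Fin 3 → Fin 4 → K)) (ℓ : (Fin 3 → Fin 4 → K) →ₗ[K] K)
    (w : Fin 3 → Fin 4 → K)
    (hJ : ∀ y : Fin 3 → Fin 4 → K,
      (Matrix.of ![v, X y 0, y 1, y 2]).permanent + (Matrix.of ![v, y 0, X y 1, y 2]).permanent +
          (Matrix.of ![v, y 0, y 1, X y 2]).permanent =
        ℓ y * ((Matrix.of ![v, w 0, y 1, y 2]).permanent + (Matrix.of ![v, y 0, w 1, y 2]).permanent +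
          (Matrix.of ![v, y 0, y 1, w 2]).permanent))
    (h : ∀ y, ℓ y = 0 → ∀ t : K,
      (Matrix.of ![v, (y + t • X y) 0, (y + t • X y) 1, (y + t • X y) 2]).permanent =
        (Matrix.of ![v, y 0, y 1, y 2]).permanent) :
    ∃ y, ℓ y = 0 ∧ X y = 0 ∧ (Matrix.of ![v, y 0, y 1, y 2]).permanent ≠ 0 := by
  have hv0 : v ≠ 0 := fun h0 => hv 0 (by rw [h0, Pi.zero_apply])
  obtain ⟨y, hy, hF⟩ := exists_permanent_ne_zero_of_ker hv0 ℓ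
  exact ⟨y, hy, eq_zero_on_hyperplane_of_flow_of_jacobian hv X ℓ w hJ h y hy, hF⟩

/-- **`hrig` in the full-space case `ℓ = 0`** (no Jacobian hypothesis). [folklore] -/
theorem exists_good_point_of_flow_zero [CharZero K] {v : Fin 4 → K} (hv : ∀ j, v j ≠ 0)
    (X : (Fin 3 → Fin 4 → K) →ₗ[K] (Fin 3 → Fin 4 → K))
    (h : ∀ y, (0 : (Fin 3 → Fin 4 → K) →ₗ[K] K) y = 0 → ∀ t : K,
      (Matrix.of ![v, (y + t • X y) 0, (y + t • X y) 1, (y + t • X y) 2]).permanent =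
        (Matrix.of ![v, y 0, y 1, y 2]).permanent) :
    ∃ y, (0 : (Fin 3 → Fin 4 → K) →ₗ[K] K) y = 0 ∧ X y = 0 ∧ (Matrix.of ![v, y 0, y 1, y 2]).permanent ≠ 0 := by
  have hX : X = 0 := eq_zero_of_flow hv X fun y t => h y (LinearMap.zero_apply y) t
  have hv0 : v ≠ 0 := fun h0 => hv 0 (by rw [h0, Pi.zero_apply])
  obtain ⟨y, hy, hF⟩ := exists_permanent_ne_zero_of_ker hv0 (0 : (Fin 3 → Fin 4 → K) →ₗ[K] K)
  exact ⟨y, hy, by rw [hX, LinearMap.zero_apply], hF⟩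

end Summit.ValiantsHypothesis.ValiantsHypothesis.Theorems.SymPencilPerFourHyperplaneFlow

end
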